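import Mathlib
import HarnessLib
import Summits.ValiantsHypothesis.ValiantsHypothesis.Theorems.LacunarySymmetroidMatrixDescartesProductPlusOneTameCalculus
import Summits.ValiantsHypothesis.ValiantsHypothesis.Theorems.LacunarySymmetroidMatrixDescartesProductPlusOneRowCalibration

/-!
# ValiantsHypothesis / LacunarySymmetroid — crux `MatrixDescartes` (stmt-ValiantsHypothesis-18050, V1),
# LINE (A) «product_plus_one», research stub `stub_classRowK3`: the TAME SECTOR of the `K = 3` row is LINEAR in `m`

`tame_sector_pos_roots`: for `m` trinomials `g_j = a_j + b_j X^(e+1) + c_j X^(e+k+2)` on a common support with OPPOSITE extreme signs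
(`a_j c_j < 0`) and support ratio `q/p = (e+k+2)/(e+1) ≤ 4` (`k ≤ 3e+2`), and every real `κ`,
`Z₊(κ + ∏_j g_j) ≤ 2m + 2` — uniformly in `e`, `k` (hence in arbitrarily LACUNARY supports `{0, p, q}` with `q ≤ 4p`), against the
Descartes ceiling `C(m+2,2) − 1`.  Mechanism (`…TameCalculus`): each factor has ≤ 1 positive zero (Descartes, one sign change), so
`(0,∞)` minus the zeros of the product has ≤ m+1 components; on each, the normalised logarithmic derivative `Ψ` is strictly decreasing
(`hasDerivAt_psi_neg`), so by Rolle (twice) a member has ≤ 2 zeros per component.  `tame_sector_class`: the same in the line's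
member shape `C c * X ^ (m * d 0) + ∏ j, Σ_l C (a j l) * X ^ (d l)` with `d 0 < d 1 < d 2`, `d 2 − d 0 ≤ 4 (d 1 − d 0)`, coupled letter
`l₀ = 0` (bottom) and `a j 0 * a j 2 < 0`.

CALIBRATION (crit-6 READ #13 price): the constant is not sharp.  In the sector every factor has EXACTLY one positive zero, simple for
that factor, so `P = ∏ g_j` changes sign at each zero of odd multiplicity; a member `P = −κ` only visits the components where `P` has
the sign of `−κ`, which halves the count: `Z₊ ≤ m + 2` is what the same argument gives with sign bookkeeping (not formalised here), and
`m` is realised (m factors with distinct simple zeros, `|κ|` small).  So the sector's truth is `m + O(1)`; `2m + 2` is the sign-blind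
bound.  Nearest in-tree cousin of the count: the «2n log-concave bumps» of `…KPlusLogSqLawRankOneWitness` (rank-one commuting pencils).

SECTOR BOUNDARY (crit-1 VERDICT #74 (b)): `a_j c_j < 0` for ALL `j` is the «no-dip» sector — ONE dip factor (`a_j c_j > 0`: no positive zero or
two, log-convex near its minimum) already leaves it, as does ratio `> 4` (the certificate `key_identity` ends exactly at 4) and the middle
coupling; the top coupling is the `x ↦ 1/x` mirror (`…ProductPlusOneTameReverse`).

HONEST FRAMING: a SECTOR of the `K = 3` row (opposite extreme signs, bottom coupling, ratio ≤ 4): NOT `stub_classRowK3`, not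
`stub_polyLaw`, not `ProductPlusOneMDR`, not `MatrixDescartes`, not Conjecture B; `VP ≠ VNP` is NOT proved.  No definitions, no named
facts; Mathlib + the lane files.
-/

-- `Summit.ValiantsHypothesis.ValiantsHypothesis.…` is the tree's mandated single-conjunct layout (Sub = Summit).
set_option linter.dupNamespace false

namespace Summit.ValiantsHypothesis.ValiantsHypothesis.Theorems.LacunarySymmetroidMatrixDescartes

namespace ProductPlusOne

open Polynomial Finset
open scoped BigOperators

/-! ### One factor -/

/-- Evaluation of a factor. [folklore] -/
theorem eval_trinomial (a b c : ℝ) (e k : ℕ) (x : ℝ) :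
    eval x (C a + C b * X ^ (e + 1) + C c * X ^ (e + k + 2)) = a + b * x ^ (e + 1) + c * x ^ (e + k + 2) := by
  simp only [eval_add, eval_mul, eval_C, eval_pow, eval_X]

/-- Coefficients of a factor. [folklore] -/
theorem coeff_trinomial (a b c : ℝ) (e k : ℕ) (i : ℕ) :
    (C a + C b * X ^ (e + 1) + C c * X ^ (e + k + 2) : ℝ[X]).coeff i
      = (if i = 0 then a else 0) + (if i = e + 1 then b else 0) + (if i = e + k + 2 then c else 0) := by
  simp only [coeff_add, coeff_C, coeff_C_mul_X_pow]

/-- A factor with `a c < 0` is a nonzero polynomial. [folklore] -/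
theorem trinomial_ne_zero (a b c : ℝ) (e k : ℕ) (hac : a * c < 0) :
    (C a + C b * X ^ (e + 1) + C c * X ^ (e + k + 2) : ℝ[X]) ≠ 0 := by
  intro h
  have h0 := congrArg (fun p : ℝ[X] => p.coeff 0) h
  simp only [coeff_trinomial, coeff_zero, if_true] at h0
  rw [if_neg (by omega), if_neg (by omega), add_zero, add_zero] at h0
  rw [h0, zero_mul] at hac
  exact lt_irrefl 0 hac

/-- Evaluation of the derivative of a factor: `g′(x) = x^e · ((e+1) b + (e+k+2) c x^{k+1})`. [folklore] -/
theorem eval_derivative_trinomial (a b c : ℝ) (e k : ℕ) (x : ℝ) :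
    eval x (derivative (C a + C b * X ^ (e + 1) + C c * X ^ (e + k + 2)))
      = x ^ e * ((e + 1 : ℝ) * b + (e + k + 2 : ℝ) * c * x ^ (k + 1)) := by
  simp only [derivative_add, derivative_C, derivative_C_mul_X_pow, zero_add, eval_add, eval_mul, eval_C, eval_pow,
    eval_X, Nat.add_sub_cancel, show e + k + 2 - 1 = e + k + 1 by omega]
  push_cast
  ring

/-- **A factor of the tame sector has at most one positive zero** (Descartes: one sign change). [folklore] -/
theorem trinomial_pos_roots_le_one (a b c : ℝ) (e k : ℕ) (hac : a * c < 0) :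
    ((C a + C b * X ^ (e + 1) + C c * X ^ (e + k + 2) : ℝ[X]).roots.toFinset.filter (fun t => 0 < t)).card ≤ 1 := by
  have h1 : (0 : ℕ) ≠ e + 1 := by omega
  have h2 : (0 : ℕ) ≠ e + k + 2 := by omega
  have h3 : e + 1 ≠ e + k + 2 := by omega
  rcases mul_neg_iff.mp hac with ⟨ha, hc⟩ | ⟨ha, hc⟩
  swap
  · -- a < 0 < c
    rcases le_or_gt 0 b with hb | hb
    · refine (StubVLawTwo.card_filter_pos_le_countP _).trans
        (countP_pos_roots_le_one_of_extreme _ 0 (fun i hi => ?_) (Or.inl (fun i hi => absurd hi (Nat.not_lt_zero i))))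
      rw [coeff_trinomial, if_neg hi]
      split_ifs <;> linarith
    · rw [← roots_neg]
      refine (StubVLawTwo.card_filter_pos_le_countP _).trans
        (countP_pos_roots_le_one_of_extreme _ (e + k + 2) (fun i hi => ?_) (Or.inr (fun i hi => ?_)))
      · rw [coeff_neg, coeff_trinomial, if_neg hi]
        split_ifs <;> linarith
      · rw [coeff_neg, coeff_trinomial, if_neg (by omega), if_neg (by omega), if_neg (by omega)]
        ring
  · -- c < 0 < a
    rcases le_or_gt 0 b with hb | hb
    · refine (StubVLawTwo.card_filter_pos_le_countP _).trans
        (countP_pos_roots_le_one_of_extreme _ (e + k + 2) (fun i hi => ?_) (Or.inr (fun i hi => ?_)))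
      · rw [coeff_trinomial, if_neg hi]
        split_ifs <;> linarith
      · rw [coeff_trinomial, if_neg (by omega), if_neg (by omega), if_neg (by omega)]
        ring
    · rw [← roots_neg]
      refine (StubVLawTwo.card_filter_pos_le_countP _).trans
        (countP_pos_roots_le_one_of_extreme _ 0 (fun i hi => ?_) (Or.inl (fun i hi => absurd hi (Nat.not_lt_zero i))))
      rw [coeff_neg, coeff_trinomial, if_neg hi]
      split_ifs <;> linarith

/-! ### The product -/

/-- Evaluation of the product. [folklore] -/
theorem eval_prod_trinomial {m : ℕ} (a b c : Fin m → ℝ) (e k : ℕ) (x : ℝ) :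
    eval x (∏ j, (C (a j) + C (b j) * X ^ (e + 1) + C (c j) * X ^ (e + k + 2)))
      = ∏ j, (a j + b j * x ^ (e + 1) + c j * x ^ (e + k + 2)) := by
  rw [eval_prod]
  exact Finset.prod_congr rfl (fun j _ => eval_trinomial _ _ _ e k x)

/-- The product is a nonzero polynomial. [folklore] -/
theorem prod_trinomial_ne_zero {m : ℕ} (a b c : Fin m → ℝ) (e k : ℕ) (hac : ∀ j, a j * c j < 0) :
    (∏ j, (C (a j) + C (b j) * X ^ (e + 1) + C (c j) * X ^ (e + k + 2)) : ℝ[X]) ≠ 0 :=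
  Finset.prod_ne_zero_iff.mpr (fun j _ => trinomial_ne_zero _ _ _ e k (hac j))

/-- **The product has at most `m` positive zeros.** [folklore] -/
theorem prod_trinomial_pos_roots_le {m : ℕ} (a b c : Fin m → ℝ) (e k : ℕ) (hac : ∀ j, a j * c j < 0) :
    ((∏ j, (C (a j) + C (b j) * X ^ (e + 1) + C (c j) * X ^ (e + k + 2)) : ℝ[X]).roots.toFinset.filter
      (fun t => 0 < t)).card ≤ m := by
  classical
  have hsub : ((∏ j, (C (a j) + C (b j) * X ^ (e + 1) + C (c j) * X ^ (e + k + 2)) : ℝ[X]).roots.toFinset.filter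
      (fun t => 0 < t)) ⊆ Finset.univ.biUnion (fun j =>
        ((C (a j) + C (b j) * X ^ (e + 1) + C (c j) * X ^ (e + k + 2) : ℝ[X]).roots.toFinset.filter (fun t => 0 < t))) := by
    intro x hx
    rw [mem_filter, Multiset.mem_toFinset, mem_roots (prod_trinomial_ne_zero a b c e k hac), IsRoot.def,
      eval_prod, Finset.prod_eq_zero_iff] at hx
    obtain ⟨⟨j, _, hj⟩, hx0⟩ := hx
    rw [mem_biUnion]
    refine ⟨j, mem_univ _, ?_⟩
    rw [mem_filter, Multiset.mem_toFinset, mem_roots (trinomial_ne_zero _ _ _ e k (hac j)), IsRoot.def]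
    exact ⟨hj, hx0⟩
  refine (card_le_card hsub).trans (card_biUnion_le.trans ?_)
  calc ∑ j, (((C (a j) + C (b j) * X ^ (e + 1) + C (c j) * X ^ (e + k + 2) : ℝ[X]).roots.toFinset.filter
          (fun t => 0 < t))).card
      ≤ ∑ _j : Fin m, 1 := Finset.sum_le_sum (fun j _ => trinomial_pos_roots_le_one _ _ _ e k (hac j))
    _ = m := by simp

/-- **`P′(w) = P(w)·w^e·Ψ(w)` off the zeros** (logarithmic derivative of the product). [folklore] -/
theorem eval_derivative_prod {m : ℕ} (a b c : Fin m → ℝ) (e k : ℕ) {w : ℝ}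
    (hg : ∀ j, a j + b j * w ^ (e + 1) + c j * w ^ (e + k + 2) ≠ 0) :
    eval w (derivative (∏ j, (C (a j) + C (b j) * X ^ (e + 1) + C (c j) * X ^ (e + k + 2))))
      = (∏ j, (a j + b j * w ^ (e + 1) + c j * w ^ (e + k + 2))) * w ^ e
        * ∑ j, ((e + 1 : ℝ) * b j + (e + k + 2 : ℝ) * c j * w ^ (k + 1))
            / (a j + b j * w ^ (e + 1) + c j * w ^ (e + k + 2)) := by
  classical
  rw [derivative_prod_finset, eval_finsetSum, Finset.mul_sum]
  refine Finset.sum_congr rfl (fun j _ => ?_)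
  rw [eval_mul, eval_prod, eval_derivative_trinomial]
  have hP : (∏ i ∈ Finset.univ.erase j, eval w (C (a i) + C (b i) * X ^ (e + 1) + C (c i) * X ^ (e + k + 2)))
      = (∏ i, (a i + b i * w ^ (e + 1) + c i * w ^ (e + k + 2))) / (a j + b j * w ^ (e + 1) + c j * w ^ (e + k + 2)) := by
    rw [eq_div_iff (hg j)]
    have h := Finset.prod_erase_mul (Finset.univ) (fun i => a i + b i * w ^ (e + 1) + c i * w ^ (e + k + 2)) (Finset.mem_univ j)
    rw [← h]
    congr 1
    exact Finset.prod_congr rfl (fun i _ => eval_trinomial _ _ _ e k w)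
  rw [hP, div_eq_mul_inv, div_eq_mul_inv]
  ring

/-- Rolle for a member: between two zeros of `κ + P` lies a zero of `P′`. [folklore] -/
theorem exists_deriv_root_between {m : ℕ} (a b c : Fin m → ℝ) (e k : ℕ) (κ : ℝ) {z z' : ℝ} (hzz : z < z')
    (hz : eval z (C κ + ∏ j, (C (a j) + C (b j) * X ^ (e + 1) + C (c j) * X ^ (e + k + 2))) = 0)
    (hz' : eval z' (C κ + ∏ j, (C (a j) + C (b j) * X ^ (e + 1) + C (c j) * X ^ (e + k + 2))) = 0) :
    ∃ w ∈ Set.Ioo z z', eval w (derivative (∏ j, (C (a j) + C (b j) * X ^ (e + 1) + C (c j) * X ^ (e + k + 2)))) = 0 := by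
  obtain ⟨w, hw, hw'⟩ := exists_deriv_eq_zero (f := fun x =>
      eval x (C κ + ∏ j, (C (a j) + C (b j) * X ^ (e + 1) + C (c j) * X ^ (e + k + 2))))
    hzz (Polynomial.continuous _).continuousOn (hz.trans hz'.symm)
  refine ⟨w, hw, ?_⟩
  rw [Polynomial.deriv, derivative_add, derivative_C, zero_add] at hw'
  exact hw'

/-- Rolle for `Ψ`: on the tame sector `Ψ` cannot take the same value at two points of a zero-free interval (`m ≥ 1`). [this file's lemma] -/
theorem psi_injective {m : ℕ} (hm : 0 < m) (a b c : Fin m → ℝ) (e k : ℕ) (hk : k ≤ 3 * e + 2)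
    (hac : ∀ j, a j * c j < 0) {w₁ w₂ : ℝ} (hw₁ : 0 < w₁) (hw : w₁ < w₂)
    (hfree : ∀ t ∈ Set.Icc w₁ w₂, ∀ j, a j + b j * t ^ (e + 1) + c j * t ^ (e + k + 2) ≠ 0)
    (heq : (∑ j, ((e + 1 : ℝ) * b j + (e + k + 2 : ℝ) * c j * w₁ ^ (k + 1)) / (a j + b j * w₁ ^ (e + 1) + c j * w₁ ^ (e + k + 2)))
      = ∑ j, ((e + 1 : ℝ) * b j + (e + k + 2 : ℝ) * c j * w₂ ^ (k + 1)) / (a j + b j * w₂ ^ (e + 1) + c j * w₂ ^ (e + k + 2))) :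
    False := by
  have hcont : ContinuousOn (fun y : ℝ => ∑ j, ((e + 1 : ℝ) * b j + (e + k + 2 : ℝ) * c j * y ^ (k + 1))
      / (a j + b j * y ^ (e + 1) + c j * y ^ (e + k + 2))) (Set.Icc w₁ w₂) := by
    intro t ht
    obtain ⟨D, _, hD⟩ := hasDerivAt_psi_neg hm a b c e k hk hac (hw₁.trans_le ht.1) (hfree t ht)
    exact hD.continuousAt.continuousWithinAt
  obtain ⟨ξ, hξ, hξ'⟩ := exists_deriv_eq_zero hw hcont heq
  obtain ⟨D, hDneg, hD⟩ := hasDerivAt_psi_neg hm a b c e k hk hac (hw₁.trans hξ.1)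
    (hfree ξ ⟨hξ.1.le, hξ.2.le⟩)
  rw [hD.deriv] at hξ'
  exact hDneg.ne hξ'

/-! ### The count -/

/-- **THE TAME SECTOR IS LINEAR**: `Z₊(κ + ∏_j g_j) ≤ 2m + 2` for trinomials `g_j = a_j + b_j X^{e+1} + c_j X^{e+k+2}` with
`a_j c_j < 0` and `k ≤ 3e + 2` (support ratio `≤ 4`), every real `κ`, every `m`. [this file's theorem] -/
theorem tame_sector_pos_roots {m : ℕ} (a b c : Fin m → ℝ) (e k : ℕ) (hk : k ≤ 3 * e + 2)
    (hac : ∀ j, a j * c j < 0) (κ : ℝ) :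
    ((C κ + ∏ j, (C (a j) + C (b j) * X ^ (e + 1) + C (c j) * X ^ (e + k + 2))).roots.toFinset.filter
      (fun t => 0 < t)).card ≤ 2 * m + 2 := by
  classical
  set P : ℝ[X] := ∏ j, (C (a j) + C (b j) * X ^ (e + 1) + C (c j) * X ^ (e + k + 2)) with hPdef
  rcases Nat.eq_zero_or_pos m with hm | hm
  · subst hm
    have hP1 : P = 1 := by rw [hPdef]; exact Fintype.prod_empty _
    rw [hP1, ← C_1, ← C_add, roots_C, Multiset.toFinset_zero, Finset.filter_empty, Finset.card_empty]
    exact Nat.zero_le _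
  have hP0 : P ≠ 0 := prod_trinomial_ne_zero a b c e k hac
  by_cases hκ : κ = 0
  · subst hκ
    rw [map_zero, zero_add]
    exact (prod_trinomial_pos_roots_le a b c e k hac).trans (by omega)
  set S := (C κ + P).roots.toFinset.filter (fun t => 0 < t) with hSdef
  set Zp := P.roots.toFinset.filter (fun t => 0 < t) with hZp
  have hZcard : Zp.card ≤ m := prod_trinomial_pos_roots_le a b c e k hac
  -- members of `S` are positive zeros of `κ + P`, and `P` does not vanish at them
  have hSmem : ∀ z ∈ S, 0 < z ∧ eval z (C κ + P) = 0 := by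
    intro z hz
    rw [hSdef, mem_filter, Multiset.mem_toFinset] at hz
    by_cases h0 : C κ + P = 0
    · rw [h0, roots_zero] at hz
      exact absurd hz.1 (Multiset.notMem_zero _)
    · exact ⟨hz.2, (IsRoot.def).mp ((mem_roots h0).mp hz.1)⟩
  have hPne : ∀ z ∈ S, eval z P ≠ 0 := by
    intro z hz hPz
    have h := (hSmem z hz).2
    rw [eval_add, eval_C, hPz, add_zero] at h
    exact hκ h
  -- two members with the same number of zeros of `P` below them span a zero-free interval
  have hfree : ∀ z₁ ∈ S, ∀ z₃ ∈ S, z₁ < z₃ →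
      (Zp.filter (fun t => t < z₁)).card = (Zp.filter (fun t => t < z₃)).card →
      ∀ t ∈ Set.Icc z₁ z₃, ∀ j, a j + b j * t ^ (e + 1) + c j * t ^ (e + k + 2) ≠ 0 := by
    intro z₁ hz₁ z₃ hz₃ h13 hk13 t ht j hj
    have ht0 : 0 < t := (hSmem z₁ hz₁).1.trans_le ht.1
    have hPt : eval t P = 0 := by
      rw [hPdef, eval_prod, Finset.prod_eq_zero_iff]
      exact ⟨j, mem_univ _, by rw [eval_trinomial]; exact hj⟩
    rcases eq_or_lt_of_le ht.2 with h | h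
    · exact hPne z₃ hz₃ (h ▸ hPt)
    · have htZ : t ∈ Zp := by
        rw [hZp, mem_filter, Multiset.mem_toFinset, mem_roots hP0]
        exact ⟨hPt, ht0⟩
      have hsub : Zp.filter (fun s => s < z₁) ⊆ Zp.filter (fun s => s < z₃) := by
        intro s hs
        rw [mem_filter] at hs ⊢
        exact ⟨hs.1, hs.2.trans h13⟩
      have hstrict : Zp.filter (fun s => s < z₁) ⊂ Zp.filter (fun s => s < z₃) := by
        refine Finset.ssubset_iff_subset_ne.mpr ⟨hsub, fun heq => ?_⟩
        have ht1 : t ∈ Zp.filter (fun s => s < z₁) := by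
          rw [heq, mem_filter]
          exact ⟨htZ, h⟩
        rw [mem_filter] at ht1
        exact absurd ht1.2 (not_lt.mpr ht.1)
      exact absurd hk13 (Finset.card_lt_card hstrict).ne
  -- a zero of `P′` in a zero-free region is a zero of `Ψ`
  have hΨzero : ∀ w : ℝ, 0 < w → (∀ j, a j + b j * w ^ (e + 1) + c j * w ^ (e + k + 2) ≠ 0) →
      eval w (derivative P) = 0 →
      (∑ j, ((e + 1 : ℝ) * b j + (e + k + 2 : ℝ) * c j * w ^ (k + 1))
          / (a j + b j * w ^ (e + 1) + c j * w ^ (e + k + 2))) = 0 := by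
    intro w hw hg hd
    rw [hPdef, eval_derivative_prod a b c e k hg] at hd
    rcases mul_eq_zero.mp hd with h | h
    · rcases mul_eq_zero.mp h with h' | h'
      · exact absurd h' (Finset.prod_ne_zero_iff.mpr (fun j _ => hg j))
      · exact absurd h' (pow_ne_zero _ hw.ne')
    · exact h
  -- every fibre of `z ↦ #{zeros of P below z}` on `S` has at most two elements
  have hfiber : ∀ v ∈ S.image (fun z => (Zp.filter (fun t => t < z)).card),
      (S.filter (fun z => (Zp.filter (fun t => t < z)).card = v)).card ≤ 2 := by
    intro v _
    by_contra hcon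
    push Not at hcon
    set F := S.filter (fun z => (Zp.filter (fun t => t < z)).card = v) with hF
    have hFS : ∀ z ∈ F, z ∈ S ∧ (Zp.filter (fun t => t < z)).card = v := by
      intro z hz
      rw [hF, mem_filter] at hz
      exact hz
    have hne : F.Nonempty := Finset.card_pos.mp (by omega)
    have hz₁F : F.min' hne ∈ F := Finset.min'_mem F hne
    have hF₁card : 2 ≤ (F.erase (F.min' hne)).card := by
      rw [Finset.card_erase_of_mem hz₁F]
      omega
    have hne₁ : (F.erase (F.min' hne)).Nonempty := Finset.card_pos.mp (by omega)
    have hz₂F₁ : (F.erase (F.min' hne)).min' hne₁ ∈ F.erase (F.min' hne) := Finset.min'_mem _ hne₁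
    have hne₂ : ((F.erase (F.min' hne)).erase ((F.erase (F.min' hne)).min' hne₁)).Nonempty :=
      Finset.card_pos.mp (by rw [Finset.card_erase_of_mem hz₂F₁]; omega)
    obtain ⟨z₃, hz₃F₂⟩ := hne₂
    set z₁ := F.min' hne with hz₁
    set z₂ := (F.erase z₁).min' hne₁ with hz₂
    have hz₂F : z₂ ∈ F := Finset.mem_of_mem_erase hz₂F₁
    have hz₃F₁ : z₃ ∈ F.erase z₁ := Finset.mem_of_mem_erase hz₃F₂
    have hz₃F : z₃ ∈ F := Finset.mem_of_mem_erase hz₃F₁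
    have h12 : z₁ < z₂ :=
      lt_of_le_of_ne (Finset.min'_le F z₂ hz₂F) (Finset.ne_of_mem_erase hz₂F₁).symm
    have h23 : z₂ < z₃ :=
      lt_of_le_of_ne (Finset.min'_le _ z₃ hz₃F₁) (Finset.ne_of_mem_erase hz₃F₂).symm
    obtain ⟨hz₁S, hk₁⟩ := hFS z₁ hz₁F
    obtain ⟨hz₂S, _⟩ := hFS z₂ hz₂F
    obtain ⟨hz₃S, hk₃⟩ := hFS z₃ hz₃F
    have free13 := hfree z₁ hz₁S z₃ hz₃S (h12.trans h23) (hk₁.trans hk₃.symm)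
    obtain ⟨w₁, hw₁, hd₁⟩ := exists_deriv_root_between a b c e k κ h12 (hSmem z₁ hz₁S).2 (hSmem z₂ hz₂S).2
    obtain ⟨w₂, hw₂, hd₂⟩ := exists_deriv_root_between a b c e k κ h23 (hSmem z₂ hz₂S).2 (hSmem z₃ hz₃S).2
    have hw₁pos : 0 < w₁ := (hSmem z₁ hz₁S).1.trans hw₁.1
    have hw₁₂ : w₁ < w₂ := hw₁.2.trans hw₂.1
    have hIcc : Set.Icc w₁ w₂ ⊆ Set.Icc z₁ z₃ :=
      fun t ht => ⟨hw₁.1.le.trans ht.1, ht.2.trans hw₂.2.le⟩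
    have hg₁ := free13 w₁ (hIcc ⟨le_rfl, hw₁₂.le⟩)
    have hg₂ := free13 w₂ (hIcc ⟨hw₁₂.le, le_rfl⟩)
    have hΨ₁ := hΨzero w₁ hw₁pos hg₁ hd₁
    have hΨ₂ := hΨzero w₂ (hw₁pos.trans hw₁₂) hg₂ hd₂
    exact psi_injective hm a b c e k hk hac hw₁pos hw₁₂ (fun t ht => free13 t (hIcc ht)) (hΨ₁.trans hΨ₂.symm)
  have himg : S.image (fun z => (Zp.filter (fun t => t < z)).card) ⊆ Finset.range (m + 1) := by
    intro v hv
    rw [Finset.mem_image] at hv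
    obtain ⟨z, _, rfl⟩ := hv
    rw [Finset.mem_range]
    exact Nat.lt_succ_of_le ((Finset.card_filter_le _ _).trans hZcard)
  calc S.card = ∑ v ∈ S.image (fun z => (Zp.filter (fun t => t < z)).card),
        (S.filter (fun z => (Zp.filter (fun t => t < z)).card = v)).card :=
        Finset.card_eq_sum_card_image _ S
    _ ≤ ∑ _v ∈ S.image (fun z => (Zp.filter (fun t => t < z)).card), 2 := Finset.sum_le_sum hfiber
    _ = 2 * (S.image (fun z => (Zp.filter (fun t => t < z)).card)).card := by
        rw [Finset.sum_const, smul_eq_mul, mul_comm]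
    _ ≤ 2 * (m + 1) :=
        Nat.mul_le_mul_left 2 ((Finset.card_le_card himg).trans (by rw [Finset.card_range]))
    _ = 2 * m + 2 := by ring

/-- **THE TAME SECTOR OF THE `K = 3` ROW, line shape** (`C c * X ^ (m * d l₀) + ∏ j, fewnomial d (a j)` unfolded verbatim, coupled
letter `l₀ = 0` = the bottom exponent): for supports `d 0 < d 1 < d 2` with `d 2 − d 0 ≤ 4·(d 1 − d 0)` and factors with
`a j 0 · a j 2 < 0`, every member has at most `2m + 2` positive zeros. [this file's theorem] -/
theorem tame_sector_class {m : ℕ} (d : Fin 3 → ℕ) (h01 : d 0 < d 1) (h12 : d 1 < d 2)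
    (h4 : d 2 - d 0 ≤ 4 * (d 1 - d 0)) (a : Fin m → Fin 3 → ℝ) (hac : ∀ j, a j 0 * a j 2 < 0) (c : ℝ) :
    ((C c * X ^ (m * d 0) + ∏ j, ∑ l, C (a j l) * X ^ (d l) : ℝ[X]).roots.toFinset.filter (fun t => 0 < t)).card
      ≤ 2 * m + 2 := by
  classical
  obtain ⟨e, he⟩ : ∃ e, d 1 = d 0 + e + 1 := ⟨d 1 - d 0 - 1, by omega⟩
  obtain ⟨k, hk⟩ : ∃ k, d 2 = d 0 + e + k + 2 := ⟨d 2 - d 1 - 1, by omega⟩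
  have hk3 : k ≤ 3 * e + 2 := by omega
  have hfac : ∀ j, (∑ l, C (a j l) * X ^ (d l) : ℝ[X])
      = X ^ (d 0) * (C (a j 0) + C (a j 1) * X ^ (e + 1) + C (a j 2) * X ^ (e + k + 2)) := by
    intro j
    rw [Fin.sum_univ_three, he, hk]
    ring
  have hmem : (C c * X ^ (m * d 0) + ∏ j, ∑ l, C (a j l) * X ^ (d l) : ℝ[X])
      = X ^ (m * d 0) * (C c + ∏ j, (C (a j 0) + C (a j 1) * X ^ (e + 1) + C (a j 2) * X ^ (e + k + 2))) := by
    rw [Finset.prod_congr rfl (fun j _ => hfac j), Finset.prod_mul_distrib, Finset.prod_const, Finset.card_univ,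
      Fintype.card_fin, ← pow_mul, mul_comm (d 0) m]
    ring
  rw [hmem]
  by_cases h0 : (X ^ (m * d 0) * (C c + ∏ j, (C (a j 0) + C (a j 1) * X ^ (e + 1) + C (a j 2) * X ^ (e + k + 2)))
      : ℝ[X]) = 0
  · rw [h0, roots_zero, Multiset.toFinset_zero, Finset.filter_empty, Finset.card_empty]
    exact Nat.zero_le _
  · rw [roots_mul h0, roots_pow, roots_X, Multiset.toFinset_add, Finset.filter_union]
    refine (Finset.card_union_le _ _).trans ?_
    have hz : (((m * d 0) • ({0} : Multiset ℝ)).toFinset.filter (fun t => 0 < t)) = ∅ := by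
      rw [Finset.filter_eq_empty_iff]
      intro t ht
      rw [Multiset.mem_toFinset] at ht
      have h00 := Multiset.mem_singleton.mp (Multiset.mem_of_mem_nsmul ht)
      rw [h00]
      exact lt_irrefl 0
    rw [hz, Finset.card_empty, zero_add]
    exact tame_sector_pos_roots (fun j => a j 0) (fun j => a j 1) (fun j => a j 2) e k hk3 hac c

/-- **All real zeros, same-parity supports**: if moreover `d 0 + d 2` is even, the reflected member `h(−X)` lies in the same sector
(`class_comp_neg_X`), so every member has at most `2(2m+2) + 1` distinct REAL zeros. [this file's theorem] -/
theorem tame_sector_class_real {m : ℕ} (d : Fin 3 → ℕ) (h01 : d 0 < d 1) (h12 : d 1 < d 2)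
    (h4 : d 2 - d 0 ≤ 4 * (d 1 - d 0)) (hev : Even (d 0 + d 2)) (a : Fin m → Fin 3 → ℝ)
    (hac : ∀ j, a j 0 * a j 2 < 0) (c : ℝ) :
    (C c * X ^ (m * d 0) + ∏ j, ∑ l, C (a j l) * X ^ (d l) : ℝ[X]).roots.toFinset.card ≤ 2 * (2 * m + 2) + 1 := by
  have h1 := card_roots_le_pos_add_reflect_add_one (C c * X ^ (m * d 0) + ∏ j, ∑ l, C (a j l) * X ^ (d l) : ℝ[X])
  rw [class_comp_neg_X] at h1
  have h2 := tame_sector_class d h01 h12 h4 a hac c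
  have hac' : ∀ j, ((-1 : ℝ) ^ (d 0) * a j 0) * ((-1 : ℝ) ^ (d 2) * a j 2) < 0 := by
    intro j
    have hsq : ((-1 : ℝ) ^ (d 0)) * ((-1 : ℝ) ^ (d 2)) = 1 := by
      rw [← pow_add]
      exact Even.neg_one_pow hev
    have : ((-1 : ℝ) ^ (d 0) * a j 0) * ((-1 : ℝ) ^ (d 2) * a j 2) = a j 0 * a j 2 := by
      calc ((-1 : ℝ) ^ (d 0) * a j 0) * ((-1 : ℝ) ^ (d 2) * a j 2)
          = (((-1 : ℝ) ^ (d 0)) * ((-1 : ℝ) ^ (d 2))) * (a j 0 * a j 2) := by ring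
        _ = a j 0 * a j 2 := by rw [hsq, one_mul]
    rw [this]
    exact hac j
  have h3 := tame_sector_class d h01 h12 h4 (fun j l => (-1 : ℝ) ^ (d l) * a j l) hac' ((-1) ^ (m * d 0) * c)
  beta_reduce at h3
  omega

end ProductPlusOne

end Summit.ValiantsHypothesis.ValiantsHypothesis.Theorems.LacunarySymmetroidMatrixDescartes
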